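import Literature.Analysis.FunctionSpaces.FourierSobolevNormEmbeddingSubcriticalTools
import HarnessLib

/-!
# The subcritical Sobolev embeddings `Ḣ^s(ℝ³) ⊂ L^{6/(3−2s)}(ℝ³)`, `0 < s < 3/2`
# (Bahouri–Chemin–Danchin 2011, Thm. 1.38 with `d = 3`)

Topic `Analysis/FunctionSpaces`; sibling proof file of `FourierSobolevNormEmbeddingProofs.lean` (the case
`s = 1/2`, `p = 3`, which stays untouched). Theorems only; no definitions, no named facts, no `sorry`. It
**proves**

* `Literature.Analysis.FunctionSpaces.eLpNorm_le_eHomSobolevSeminorm_of_lt_threeHalves` — for every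
  `0 < s < 3/2` there is a constant `C = C_s` such that `‖f‖_{L^p(ℝ³)} ≤ C ‖f‖_{Ḣ^s(ℝ³)}`, `p = 6/(3 − 2s)`, for
  every `f ∈ L²(ℝ³; F)` (`F` any complex Hilbert space), where `‖f‖_{Ḣ^s}² = ∫ ‖ξ‖^{2s} ‖𝓕f(ξ)‖² dξ` is the
  Fourier-side homogeneous seminorm `Function.eHomSobolevSeminorm s` of `FourierSobolevNorm.lean`
  (Bahouri–Chemin–Danchin 2011, Def. 1.31); the statement is Bahouri–Chemin–Danchin 2011, Thm. 1.38 with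
  `d = 3`, `0 < s < d/2`, `p = 2d/(d − 2s)`.

## Source and proof

Exactly the frequency-splitting proof of Chemin–Xu 1997 (Introduction, (5) via (8)–(10), pp. 722–724)
formalised for `s = 1/2` in `FourierSobolevNormEmbeddingProofs.lean`, run with a general exponent: write
`f = f_{1,A} + f_{2,A}`, `f_{1,A} = 𝓕⁻¹(1_{B(0,A)} 𝓕f)`; by Cauchy–Schwarz
`‖f_{1,A}‖_∞ ≤ (∫_{B(0,A)} ‖ξ‖^{−2s})^{1/2} ‖f‖_{Ḣ^s} = A^{(3−2s)/2} J_s^{1/2} ‖f‖_{Ḣ^s}` with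
`J_s = ∫_{‖ξ‖<1} ‖ξ‖^{−2s} dξ ∈ (0, ∞)` (`2s < 3`); choosing `A_t = (t/(2 J_s^{1/2} ‖f‖_{Ḣ^s}))^{2/(3−2s)}`
makes `‖f_{1,A_t}‖_∞ ≤ t/2`, so `vol{‖f‖ > t} ≤ 4 t⁻² ∫_{‖ξ‖ ≥ A_t} ‖𝓕f‖²` (Bienaymé–Chebyshev + Plancherel, the
`s`-independent lemmas `SobolevEmbeddingHalf.exists_high_frequency_part` / `volume_norm_gt_le` of the sibling
file, reused); the layer-cake formula `‖f‖_p^p = p ∫₀^∞ t^{p−1} vol{‖f‖ > t} dt` and Fubini–Tonelli in `(t, ξ)`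
(`∫_{0<t≤2m‖ξ‖^{(3−2s)/2}} t^{p−3} dt = (2m)^{p−2} ‖ξ‖^{2s}/(p − 2)`, since `(p − 2)(3 − 2s)/2 = 2s`) give
`‖f‖_p^p ≤ (4p/(p−2)) (2 J_s^{1/2})^{p−2} ‖f‖_{Ḣ^s}^p`.

The tools (power integral and Tonelli step with the power-law cut-off `A_t = (t/(2m))^γ`, the layer-cake step
for a general exponent, the ball integrals `∫_{B(0,A)} ‖ξ‖^{−2s} dξ = A^{3−2s} J_s` and the Cauchy–Schwarz
low-frequency bound) are in `FourierSobolevNormEmbeddingSubcriticalTools.lean`; this file is the assembly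
`SobolevEmbeddingSub.exists_eLpNorm_le_const_mul` (for an `L²` class, degenerate cases apart) and the
function-level statement.

Consumer: the fluid-computer level dictionary (`Summits/NavierStokesRegularity/FluidComputer/SobolevLadder*`),
which turns Leray's `L^p` blow-up rates into `Ḣ^s` rates (Robinson–Sadowski 2014, Cor. 10) through this
embedding.

## References

* [BahouriCheminDanchin2011] H. Bahouri, J.-Y. Chemin, R. Danchin, *Fourier Analysis and Nonlinear Partial
  Differential Equations*, Grundlehren 343, Springer (2011), Def. 1.31, Thm. 1.38.
* [CheminXu1997] J.-Y. Chemin, C.-J. Xu, *Inclusions de Sobolev en calcul de Weyl–Hörmander et champs de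
  vecteurs sous-elliptiques*, Ann. Sci. École Norm. Sup. (4) 30 (1997) 719–751, Introduction pp. 722–724,
  (5), (8)–(10).
-/

noncomputable section

open MeasureTheory SchwartzMap FourierTransform Complex Set Filter
open scoped ENNReal NNReal Topology Real

namespace Literature.Analysis.FunctionSpaces

namespace SobolevEmbeddingSub

open SobolevEmbeddingHalf (exists_high_frequency_part volume_norm_gt_le)

/-! ## Assembly -/

section Main

variable {F : Type*} [NormedAddCommGroup F] [InnerProductSpace ℂ F] [CompleteSpace F]

/-- **The Sobolev inequality `Ḣ^s(ℝ³) ⊂ L^{6/(3−2s)}(ℝ³)` for an `L²` class**, `0 < s < 3/2`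
(Bahouri–Chemin–Danchin 2011, Thm. 1.38 with `d = 3`, `p = 6/(3 − 2s)`; proof of Chemin–Xu 1997, Introduction,
(5) via (8)–(10)): there is `C = C_s < ∞` with `‖f‖_{L^p} ≤ C (∫ ‖ξ‖^{2s} ‖𝓕f(ξ)‖² dξ)^{1/2}` for every
`f ∈ L²(ℝ³; F)`; here `C = (4p/(p−2))^{1/p} (2 J_s^{1/2})^{(p−2)/p}`, `J_s = ∫_{‖ξ‖<1} ‖ξ‖^{−2s} dξ`, with the
cut-off `A_t = (t / (2 J_s^{1/2} ‖f‖_{Ḣ^s}))^{2/(3−2s)}` at level `t`. [cite: BahouriCheminDanchin2011, Thm. 1.38] -/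
theorem exists_eLpNorm_le_const_mul {s : ℝ} (hs0 : 0 < s) (hs : s < 3 / 2) :
    ∃ C : ℝ≥0∞, C ≠ ∞ ∧ ∀ f₂ : Lp F 2 (volume : Measure (EuclideanSpace ℝ (Fin 3))),
      eLpNorm (f₂ : EuclideanSpace ℝ (Fin 3) → F) (ENNReal.ofReal (6 / (3 - 2 * s))) volume ≤
        C * (∫⁻ ξ, ‖ξ‖ₑ ^ (2 * s) * ‖((𝓕 f₂ : Lp F 2 (volume : Measure (EuclideanSpace ℝ (Fin 3)))) :
          EuclideanSpace ℝ (Fin 3) → F) ξ‖ₑ ^ 2) ^ (1 / 2 : ℝ) := by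
  set p : ℝ := 6 / (3 - 2 * s) with hp_def
  set γ : ℝ := 2 / (3 - 2 * s) with hγ_def
  have h3s : 0 < 3 - 2 * s := by linarith
  have hp2 : 2 < p := by
    rw [hp_def, lt_div_iff₀ h3s]
    linarith
  have hp0 : 0 < p := by linarith
  have hγ0 : 0 < γ := by positivity
  set J : ℝ≥0∞ := ∫⁻ ξ in Metric.ball (0 : EuclideanSpace ℝ (Fin 3)) 1, ‖ξ‖ₑ ^ (-(2 * s)) with hJ_def
  set c : ℝ≥0∞ := J ^ (1 / 2 : ℝ) with hc_def
  have hJ0 : J ≠ 0 := (lintegral_unitBall_rpow_neg_pos hs0.le).ne'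
  have hJtop : J ≠ ∞ := lintegral_unitBall_rpow_neg_ne_top hs
  have hc0 : c ≠ 0 := by
    rw [hc_def]
    exact (ENNReal.rpow_pos (pos_iff_ne_zero.2 hJ0) hJtop).ne'
  have hctop : c ≠ ∞ := ENNReal.rpow_ne_top_of_nonneg (by norm_num) hJtop
  set C : ℝ≥0∞ := (ENNReal.ofReal (4 * p / (p - 2)) * (2 * c) ^ (p - 2)) ^ (1 / p) with hC_def
  have h2c0 : (2 : ℝ≥0∞) * c ≠ 0 := mul_ne_zero two_ne_zero hc0
  have h2ctop : (2 : ℝ≥0∞) * c ≠ ∞ := ENNReal.mul_ne_top (by norm_num) hctop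
  have hC0 : C ≠ 0 := by
    rw [hC_def]
    refine (ENNReal.rpow_pos (pos_iff_ne_zero.2 (mul_ne_zero ?_ ?_)) (ENNReal.mul_ne_top ENNReal.ofReal_ne_top
      (ENNReal.rpow_ne_top_of_nonneg (by linarith) h2ctop))).ne'
    · exact (ENNReal.ofReal_pos.2 (div_pos (by positivity) (by linarith))).ne'
    · exact (ENNReal.rpow_pos (pos_iff_ne_zero.2 h2c0) h2ctop).ne'
  have hCtop : C ≠ ∞ :=
    ENNReal.rpow_ne_top_of_nonneg (by positivity)
      (ENNReal.mul_ne_top ENNReal.ofReal_ne_top (ENNReal.rpow_ne_top_of_nonneg (by linarith) h2ctop))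
  refine ⟨C, hCtop, fun f₂ => ?_⟩
  set G : EuclideanSpace ℝ (Fin 3) → F :=
    ((𝓕 f₂ : Lp F 2 (volume : Measure (EuclideanSpace ℝ (Fin 3)))) : EuclideanSpace ℝ (Fin 3) → F)
    with hG_def
  have hGm : AEStronglyMeasurable G volume := Lp.aestronglyMeasurable _
  set I : ℝ≥0∞ := ∫⁻ ξ, ‖ξ‖ₑ ^ (2 * s) * ‖G ξ‖ₑ ^ 2 with hI_def
  have h0 : ∀ᵐ ξ ∂(volume : Measure (EuclideanSpace ℝ (Fin 3))), ξ ≠ 0 := by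
    rw [ae_iff]; simp [measure_singleton]
  rcases eq_or_ne I 0 with hI0 | hI0
  · -- `𝓕 f = 0`, hence `f = 0`
    have hae : (fun ξ => ‖ξ‖ₑ ^ (2 * s) * ‖G ξ‖ₑ ^ 2) =ᵐ[volume] 0 :=
      (lintegral_eq_zero_iff' (((measurable_enorm.pow_const _).aemeasurable).mul (hGm.enorm.pow_const _))).1 hI0
    have hG0 : G =ᵐ[volume] 0 := by
      filter_upwards [hae, h0] with ξ hξ hξ0
      have hx0 : (‖ξ‖ₑ : ℝ≥0∞) ^ (2 * s) ≠ 0 :=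
        (ENNReal.rpow_pos (pos_iff_ne_zero.2 (by simpa using hξ0)) enorm_ne_top).ne'
      have h1 : ‖G ξ‖ₑ ^ 2 = 0 := by simpa [hx0] using hξ
      simpa using h1
    have hF0 : (𝓕 f₂ : Lp F 2 (volume : Measure (EuclideanSpace ℝ (Fin 3)))) = 0 :=
      Lp.ext (hG0.trans (Lp.coeFn_zero F 2 volume).symm)
    have hf0 : f₂ = 0 :=
      (Lp.fourierTransformₗᵢ (EuclideanSpace ℝ (Fin 3)) F).injective
        (hF0.trans (map_zero (Lp.fourierTransformₗᵢ (EuclideanSpace ℝ (Fin 3)) F)).symm)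
    have : eLpNorm (f₂ : EuclideanSpace ℝ (Fin 3) → F) (ENNReal.ofReal p) volume = 0 := by
      rw [hf0, eLpNorm_congr_ae (Lp.coeFn_zero F 2 volume), eLpNorm_zero]
    rw [this]
    exact zero_le
  rcases eq_or_ne I ∞ with hItop | hItop
  · rw [hItop, ENNReal.top_rpow_of_pos (by norm_num), ENNReal.mul_top hC0]
    exact le_top
  -- main case `0 < I < ∞`
  set K : ℝ≥0∞ := I ^ (1 / 2 : ℝ) with hK_def
  have hK0 : K ≠ 0 := (ENNReal.rpow_pos (pos_iff_ne_zero.2 hI0) hItop).ne'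
  have hKtop : K ≠ ∞ := ENNReal.rpow_ne_top_of_nonneg (by norm_num) hItop
  have hK2 : K ^ (2 : ℝ) = I := by
    rw [hK_def, ← ENNReal.rpow_mul]
    norm_num
  set m : ℝ := (c * K).toReal with hm_def
  have hm0 : 0 < m := ENNReal.toReal_pos (mul_ne_zero hc0 hK0) (ENNReal.mul_ne_top hctop hKtop)
  have hcK : ENNReal.ofReal m = c * K := ENNReal.ofReal_toReal (ENNReal.mul_ne_top hctop hKtop)
  have hdist : ∀ t : ℝ, 0 < t → volume {x | t < ‖(f₂ : EuclideanSpace ℝ (Fin 3) → F) x‖} ≤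
      (ENNReal.ofReal (t / 2) ^ 2)⁻¹ *
        ∫⁻ ξ in (Metric.ball (0 : EuclideanSpace ℝ (Fin 3)) ((t / (2 * m)) ^ γ))ᶜ, ‖G ξ‖ₑ ^ 2 := by
    intro t ht
    have hA : 0 < (t / (2 * m)) ^ γ := Real.rpow_pos_of_pos (by positivity) _
    refine volume_norm_gt_le f₂ measurableSet_ball ht ?_
    calc ∫⁻ ξ in Metric.ball (0 : EuclideanSpace ℝ (Fin 3)) ((t / (2 * m)) ^ γ), ‖G ξ‖ₑ
        ≤ ENNReal.ofReal (((t / (2 * m)) ^ γ) ^ ((3 - 2 * s) / 2)) * c * K := lintegral_ball_enorm_le_mul hGm hA s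
      _ = ENNReal.ofReal (t / 2) := by
          rw [← Real.rpow_mul (by positivity), show γ * ((3 - 2 * s) / 2) = 1 by rw [hγ_def]; field_simp,
            Real.rpow_one, mul_assoc, ← hcK, ← ENNReal.ofReal_mul (by positivity)]
          congr 1
          field_simp
  have h3 := lintegral_enorm_rpow_le f₂ hm0 hγ0 hp2 hdist
  have hexp : (p - 2) / γ = 2 * s := by
    rw [hp_def, hγ_def]
    field_simp
    ring
  rw [hexp] at h3
  -- `(2m)^{p−2} · I = (2c)^{p−2} K^p`
  have h2m : ENNReal.ofReal ((2 * m) ^ (p - 2)) = ((2 : ℝ≥0∞) * c) ^ (p - 2) * K ^ (p - 2) := by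
    rw [← ENNReal.ofReal_rpow_of_nonneg (by positivity) (by linarith), ENNReal.ofReal_mul (by norm_num), hcK,
      show ENNReal.ofReal 2 = (2 : ℝ≥0∞) by norm_num, ← mul_assoc,
      ENNReal.mul_rpow_of_nonneg _ _ (by linarith : (0 : ℝ) ≤ p - 2)]
  have hKp : K ^ (p - 2) * I = K ^ p := by
    rw [← hK2, ← ENNReal.rpow_add _ _ hK0 hKtop]
    congr 1
    ring
  have hp2' : 0 < p - 2 := by linarith
  have h4 : ∫⁻ x, ‖(f₂ : EuclideanSpace ℝ (Fin 3) → F) x‖ₑ ^ p ≤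
      ENNReal.ofReal (4 * p / (p - 2)) * ((2 : ℝ≥0∞) * c) ^ (p - 2) * K ^ p := by
    refine h3.trans (le_of_eq ?_)
    rw [show 4 * p * ((2 * m) ^ (p - 2) / (p - 2)) = 4 * p / (p - 2) * (2 * m) ^ (p - 2) by ring,
      ENNReal.ofReal_mul (div_pos (by positivity) hp2').le, h2m, ← hKp]
    ring
  have hpnorm : eLpNorm (f₂ : EuclideanSpace ℝ (Fin 3) → F) (ENNReal.ofReal p) volume =
      (∫⁻ x, ‖(f₂ : EuclideanSpace ℝ (Fin 3) → F) x‖ₑ ^ p) ^ (1 / p) := by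
    rw [eLpNorm_eq_lintegral_rpow_enorm_toReal (ne_of_gt (ENNReal.ofReal_pos.2 hp0)) ENNReal.ofReal_ne_top,
      ENNReal.toReal_ofReal hp0.le]
  rw [hpnorm]
  calc (∫⁻ x, ‖(f₂ : EuclideanSpace ℝ (Fin 3) → F) x‖ₑ ^ p) ^ (1 / p)
      ≤ (ENNReal.ofReal (4 * p / (p - 2)) * ((2 : ℝ≥0∞) * c) ^ (p - 2) * K ^ p) ^ (1 / p) :=
        ENNReal.rpow_le_rpow h4 (one_div_pos.2 hp0).le
    _ = C * K := by
        rw [ENNReal.mul_rpow_of_nonneg _ _ (one_div_pos.2 hp0).le, hC_def]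
        congr 1
        rw [← ENNReal.rpow_mul, mul_one_div_cancel hp0.ne', ENNReal.rpow_one]

end Main


end SobolevEmbeddingSub

/-- **The subcritical Sobolev embedding `Ḣ^s(ℝ³) ↪ L^{6/(3−2s)}(ℝ³)`, `0 < s < 3/2`** (Bahouri–Chemin–Danchin
2011, Thm. 1.38 with `d = 3`, `p = 2d/(d − 2s) = 6/(3 − 2s)`): there is a constant `C = C_s` with
`‖f‖_{L^{6/(3−2s)}(ℝ³)} ≤ C ‖f‖_{Ḣ^s(ℝ³)}` for every `f ∈ L²(ℝ³; F)`, `‖f‖_{Ḣ^s}` the Fourier-side seminorm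
`Function.eHomSobolevSeminorm s` (`= (∫ ‖ξ‖^{2s} ‖𝓕f(ξ)‖² dξ)^{1/2}`); here
`C = (4p/(p−2))^{1/p} (2 J_s^{1/2})^{(p−2)/p}`, `J_s = ∫_{‖ξ‖<1} ‖ξ‖^{−2s} dξ`
(`SobolevEmbeddingSub.exists_eLpNorm_le_const_mul`, the frequency-splitting proof of Chemin–Xu 1997). The case
`s = 1/2` is `eLpNorm_three_le_eHomSobolevSeminorm_half_holds` of the sibling file.
[cite: BahouriCheminDanchin2011, Thm. 1.38] -/
theorem eLpNorm_le_eHomSobolevSeminorm_of_lt_threeHalves {s : ℝ} (hs0 : 0 < s) (hs : s < 3 / 2)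
    {F : Type*} [NormedAddCommGroup F] [InnerProductSpace ℂ F] [CompleteSpace F] :
    ∃ C : ℝ≥0, ∀ f : EuclideanSpace ℝ (Fin 3) → F, MemLp f 2 volume →
      eLpNorm f (ENNReal.ofReal (6 / (3 - 2 * s))) volume ≤ C * Function.eHomSobolevSeminorm s f := by
  obtain ⟨C, hCtop, hC⟩ := SobolevEmbeddingSub.exists_eLpNorm_le_const_mul (F := F) hs0 hs
  refine ⟨C.toNNReal, fun f hf => ?_⟩
  rw [ENNReal.coe_toNNReal hCtop, Function.eHomSobolevSeminorm, dif_pos hf,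
    Literature.Analysis.FunctionSpaces.eHomSobolevSeminorm]
  have h := hC (hf.toLp f)
  rw [eLpNorm_congr_ae hf.coeFn_toLp] at h
  exact h

end Literature.Analysis.FunctionSpaces

end
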